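import Summits.CriticalPhenomena.PercolationContinuityZ3.Theorems.PercNearOneGluingNoHeavyQuantTreeRowFloorThreshold
import HarnessLib

/-!
# QUANT lane R8: CONJECTURE R — in the regime `μ{j+1..M} < x` of a tree-built law, the overshoot beyond `2j` is paid for by the
# deficit below `j`: `E[(N − 2j)⁺] ≤ E[(j − N)⁺]`; it implies typer g36's floor-resolved row `LawDec.TreeBuiltRowFloor`

builds on p205010 (kernel theorem, internal audit signed; external expert review pending)

Statement + support file (`--supports stmt-CriticalPhenomena-4575`), QUANT lane typer seat prim-quant-stmt (gen 37), rung R8 of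
`run/shared/lean/prim/quant/LADDER.md`; memo `run/shared/lean/prim/quant/prim-quant-stmt-g37/FLOORROW-G37.md` §5.

THE STATEMENT (typer g37, census level → typed here as a conjecture so that it can be cited and, if it dies, negated; NOT a route node).
For a tree-built count law `μ` on `{0..M}` at floor `x` and a layer `j` in the BINDING regime of the floor-resolved row — the `(j+1)`-tail is
below the floor, `μ{j+1..M} < x` — the first moment beyond twice the level is at most the first moment of the deficit below the level:
`∑_h (h − 2j)⁺ μ_h ≤ ∑_h (j − h)⁺ μ_h`.  Since `mean − j − j·μ{j+1..M} = ∑_{h ≤ j} (h − j) μ_h + ∑_{h ≥ j+1} (h − 2j) μ_h ≤ E(N−2j)⁺ − E(j−N)⁺`, the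
conjecture gives `mean ≤ j·(1 + μ{j+1..M})` in that regime, i.e. the Q-form of `TreeBuiltRowFloor` (typer g37, `…QuantTreeRowFloorQForm.lean`), hence
`TreeBuiltRowFloor` itself (`treeBuiltRowFloor_of_treeBuiltReflectRow`) and with it `TreeBuiltFAR` / `Quant.FarTreeRow`.  It is STRICTLY stronger than
the Q-form (the middle term `E[(2j − N); j < N ≤ 2j] ≥ 0` is dropped) and numerically still true: 0 violations on 16 759 regime instances of 21 000
random rooted forests (≤ 9 vertices, exact enumeration; typer g37 explore/routeR_trees.py), 0 on 215 954 random regime-II block-stars and under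
adversarial hill-climbing over block-stars with gates ≤ 1 and real weights ≤ 1.5 j (explore/lemmaX2.py, routeR_attack.py); the infimum of
`E(j−N)⁺ − E(N−2j)⁺` in the regime is `0`, approached by THREE `j`-BLOCKS behind gates `g ↑ 1/2` (law `(1−g)³, 3g(1−g)², 3g²(1−g), g³` on
`{0, j, 2j, 3j}`: difference `j((1−g)³ − g³)`, regime `3g² − 2g³ < x < g`) — the tight point of census-1's `IndepBlob.massRow` — while the two-block
family of `treeBuiltRowFloor_threshold_sharp` gives `j(1−a)(1−b) ≥ 0`.  WHY THIS SHAPE: for block-stars whose gates are all `≤ 1/2` and whose total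
weight is `≤ 3j` it FOLLOWS from the monotone coupling `E_p f ≤ E_{1−p} f` (`f = (W − 2j)⁺` increasing) and reflection `O ↦ Oᶜ`
(`(Σa − W − 2j)⁺ ≤ (j − W)⁺` iff `Σa ≤ 3j`) — paper, FLOORROW-G37 §5; the general case must use the regime hypothesis quantitatively (the
crude mixed-gate sufficient condition `a(L) + 2a(H) ≤ 3j` is false in the regime, explicit 7-block witness in the memo).  As a statement about
ARBITRARY laws closed under convolution it is of course false (it implies the Q-form, whose law-level convolution step is refuted by
`LawDec.not_rowFloorQConvClosed`).  HONEST STATUS: conjecture; `TreeBuiltRowFloor`, `TreeBuiltFAR`, `FarTreeRow` OPEN; RATE class log\* and the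
honest sentence of `run/shared/lean/prim/quant/README.md` unchanged.  [this work]; the gluing rows served [cite: KozmaNitzan2024, Conjecture 3 (p. 15)];
product measure [cite: Grimmett1999, §1.3 p. 10].
-/

noncomputable section

namespace Summit.CriticalPhenomena.PercolationContinuityZ3.Theorems

namespace Quant

open Finset

namespace LawDec

/-- **CONJECTURE R (reflection row; typer g37).**  For every tree-built law `μ` on `{0..M}` at floor `x` and every layer `j` with
`μ{j+1..M} < x`: `∑_h (h − 2j)⁺ μ_h ≤ ∑_h (j − h)⁺ μ_h` — the overshoot beyond `2j` is paid for by the deficit below `j`.  Implies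
`TreeBuiltRowFloor` (`treeBuiltRowFloor_of_treeBuiltReflectRow`).  Evidence and the tight family: module docstring. [this work] [status: open] -/
@[conjecture] def TreeBuiltReflectRow : Prop :=
  ∀ (x : ℝ) (M : ℕ) (μ : ℕ → ℝ), TreeBuilt x M μ → ∀ j : ℕ,
    ∑ h ∈ Finset.Ico (j + 1) (M + 1), μ h < x →
      ∑ h ∈ Finset.range (M + 1), max ((h : ℝ) - 2 * j) 0 * μ h ≤ ∑ h ∈ Finset.range (M + 1), max ((j : ℝ) - h) 0 * μ h

/-- the tail `μ{j+1..M}` as an indicator sum over `{0..M}`. [this work] -/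
theorem tail_eq_sum_ite (μ : ℕ → ℝ) (j M : ℕ) :
    ∑ h ∈ Finset.Ico (j + 1) (M + 1), μ h = ∑ h ∈ Finset.range (M + 1), if j + 1 ≤ h then μ h else 0 := by
  rw [← Finset.sum_filter]
  congr 1
  ext h
  simp only [Finset.mem_Ico, Finset.mem_filter, Finset.mem_range]
  omega

/-- **the bookkeeping identity behind Conjecture R ⟹ Q-form**: for a law of mass one on `{0..M}`,
`mean − j − j·μ{j+1..M} ≤ ∑ (h − 2j)⁺ μ_h − ∑ (j − h)⁺ μ_h` (in fact with equality up to the dropped middle term). [this work] -/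
theorem mean_sub_le_overshoot_sub_deficit (μ : ℕ → ℝ) (M j : ℕ) (hμ0 : ∀ k, 0 ≤ μ k)
    (hμ1 : ∑ h ∈ Finset.range (M + 1), μ h = 1) :
    ∑ h ∈ Finset.range (M + 1), (h : ℝ) * μ h - j - (j : ℝ) * ∑ h ∈ Finset.Ico (j + 1) (M + 1), μ h ≤
      ∑ h ∈ Finset.range (M + 1), max ((h : ℝ) - 2 * j) 0 * μ h - ∑ h ∈ Finset.range (M + 1), max ((j : ℝ) - h) 0 * μ h := by
  have hlhs : ∑ h ∈ Finset.range (M + 1), (h : ℝ) * μ h - j - (j : ℝ) * ∑ h ∈ Finset.Ico (j + 1) (M + 1), μ h =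
      ∑ h ∈ Finset.range (M + 1), ((h : ℝ) * μ h - (j : ℝ) * μ h - (j : ℝ) * (if j + 1 ≤ h then μ h else 0)) := by
    rw [Finset.sum_sub_distrib, Finset.sum_sub_distrib, ← Finset.mul_sum, ← Finset.mul_sum, hμ1, mul_one, ← tail_eq_sum_ite]
  rw [hlhs, ← Finset.sum_sub_distrib]
  refine Finset.sum_le_sum fun h _ => ?_
  -- pointwise: `h μ − j μ − j [j+1 ≤ h] μ ≤ ((h − 2j)⁺ − (j − h)⁺) μ`
  by_cases hh : j + 1 ≤ h
  · rw [if_pos hh]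
    have h1 : (j : ℝ) + 1 ≤ h := by exact_mod_cast hh
    have e1 : max ((j : ℝ) - h) 0 = 0 := max_eq_right (by linarith)
    have e2 : (h : ℝ) - 2 * j ≤ max ((h : ℝ) - 2 * j) 0 := le_max_left _ _
    rw [e1, zero_mul]
    nlinarith [hμ0 h]
  · rw [if_neg hh, mul_zero]
    have h1 : (h : ℝ) ≤ j := by exact_mod_cast (by omega : h ≤ j)
    have e1 : max ((j : ℝ) - h) 0 = j - h := max_eq_left (by linarith)
    have e2 : 0 ≤ max ((h : ℝ) - 2 * j) 0 := le_max_right _ _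
    rw [e1]
    nlinarith [hμ0 h]

/-- **Conjecture R ⟹ `TreeBuiltRowFloor`** (typer g36's floor-resolved tree row): in the binding regime `tail < x` Conjecture R gives
`mean ≤ j(1 + tail) < (1 + x) j`, contradicting the hypothesis; otherwise `x ≤ tail` is the conclusion. [this work] -/
theorem treeBuiltRowFloor_of_treeBuiltReflectRow (H : TreeBuiltReflectRow) : TreeBuiltRowFloor := by
  intro x M μ hμ j hmean
  by_contra htail
  push Not at htail
  obtain ⟨-, -, hμ0, -, hμ1, -⟩ := treeBuilt_lawFacts hμ
  have hR := H x M μ hμ j htail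
  have hb := mean_sub_le_overshoot_sub_deficit μ M j hμ0 hμ1
  have ht0 : 0 ≤ ∑ h ∈ Finset.Ico (j + 1) (M + 1), μ h := Finset.sum_nonneg fun h _ => hμ0 h
  have hj0 : (0 : ℝ) ≤ j := Nat.cast_nonneg j
  -- `mean ≤ j + j·tail ≤ j + j·x`
  have hmean' : ∑ h ∈ Finset.range (M + 1), (h : ℝ) * μ h ≤ j + (j : ℝ) * x := by
    have := mul_le_mul_of_nonneg_left htail.le hj0
    linarith
  linarith

end LawDec

/-- **Conjecture R ⟹ `Quant.FarTreeRow`** (through `TreeBuiltRowFloor`). [this work] -/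
theorem farTreeRow_of_treeBuiltReflectRow (H : LawDec.TreeBuiltReflectRow) : FarTreeRow :=
  farTreeRow_of_treeBuiltRowFloor (LawDec.treeBuiltRowFloor_of_treeBuiltReflectRow H)

end Quant

end Summit.CriticalPhenomena.PercolationContinuityZ3.Theorems
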